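import Mathlib.NumberTheory.Zsqrtd.GaussianInt
import Mathlib.NumberTheory.LSeries.HurwitzZetaEven
import Mathlib.NumberTheory.LSeries.HurwitzZetaOdd
import Mathlib.NumberTheory.LSeries.Basic
import Mathlib.Analysis.SpecialFunctions.Gamma.Beta
import Mathlib.Analysis.PSeries
import HarnessLib

/-!
# Weight-one theta series of `ℤ[i]` with periodic coefficients: the `L`-series is entire

Topic `Literature/NumberTheory/LFunctions` (next to `GaussianPrimesInSectors.lean`, Hecke
Grössencharakter `L`-functions of `ℚ(i)`). Filed for the named fact
`Literature.NumberTheory.EllipticCurves.hasEntireLFunction_congruentNumberCurve` of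
`Literature.NumberTheory.EllipticCurves.BSDAnalyticRankProofs` (continuation of `L(E_n, s)`,
`E_n : y² = x³ - n² x`; Koblitz, *Introduction to Elliptic Curves and Modular Forms*, Ch. II §5,
where `L(E_n, s) = L(χ̃_n, s)` is a Hecke `L`-series of `ℚ(i)` of exactly the shape treated
here and is proved entire by the theta-function argument formalised below; Ireland–Rosen,
Ch. 18 §5 Thm. 6 (Hecke) and §6 Thm. 7). Everything in this file is proved (Mathlib only).

## Main result

For `M ≥ 1` and a coefficient `ψ : ℤ[i] → ℂ` periodic modulo `M` (`ψ (x + M y) = ψ x`), put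
`c_ψ(m) = ∑_{x ∈ ℤ[i], N(x) = m} ψ(x) x` (`Literature.NumberTheory.LFunctions.GaussianTheta.coeff`). Then the Dirichlet series
`∑_{m ≥ 1} c_ψ(m) m^{-s} = ∑_{x ≠ 0} ψ(x) x N(x)^{-s}`, absolutely convergent for `Re s > 3/2`,
is the restriction of an entire function:

* `Literature.NumberTheory.LFunctions.GaussianTheta.exists_differentiable_eq_LSeries_coeff` —
  `∃ G, Differentiable ℂ G ∧ ∀ s, 3/2 < re s → G s = LSeries (coeff ψ) s`;
* the entire function is explicit, `Literature.GaussianTheta.thetaLFunction M ψ s =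
  (π/M)^s Γ(s)⁻¹ ∫₀^∞ θ_ψ(t) t^{s-1} dt` (`differentiable_thetaLFunction`,
  `thetaLFunction_eq_LSeries`, `LSeriesHasSum_coeff`, `LSeriesSummable_coeff`).

For an algebraic Hecke character `χ` of `ℤ[i]` of weight one and modulus `M` (Ireland–Rosen,
Ch. 18 §5: `χ((α)) = α` for `α ≡ 1 (M)`), the function `x ↦ χ((x))/x` (and `0` on `x` not
prime to `M`) is periodic modulo `M`, so `L(s, χ) = ¼ ∑_x ψ(x) x N(x)^{-s}` is of this form; for
`E_n` the character is `χ((π)) = \overline{(n²/π)₄} π`, `π ≡ 1 (2 + 2i)` (Ireland–Rosen Thm. 18.7,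
modulus `8 n²`; Koblitz's `χ̃_n`).

## The proof (Hecke 1920, §9; Koblitz Ch. II §5)

Write `θ_ψ(t) = ∑_{x ∈ ℤ[i]} ψ(x) x e^{-π t N(x)/M}` (`t > 0`). Splitting `x = c + M y` over the
`M²` classes `c` modulo `M ℤ[i]`, each class sum factors through the lattice `ℤ × ℤ` into
products of Mathlib's one-dimensional kernels (`HurwitzZeta.oddKernel a x = ∑ (m+a) e^{-π(m+a)²x}`,
`HurwitzZeta.evenKernel a x = ∑ e^{-π(m+a)²x}` at `a = c₁/M, c₂/M`, `x = M t`):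
`Θ_c(t) = M (oddKernel(c₁/M) · evenKernel(c₂/M) + i · evenKernel(c₁/M) · oddKernel(c₂/M))(M t)`
(`classTheta`, `hasSum_classTheta`), and `θ_ψ = ∑_c ψ(c) Θ_c` (`theta`, `hasSum_theta`). We
*define* `θ_ψ` by this finite formula. Then:

* decay at `∞`: `oddKernel = O(e^{-pt})`, `evenKernel = O(1)` (Mathlib), so `θ_ψ(t) = O(t^{-A})`
  for every `A` (`isBigO_atTop_theta`);
* decay at `0⁺` (theta inversion = Poisson summation, through Mathlib's functional equations
  `oddKernel a x = x^{-3/2} sinKernel a (1/x)`, `evenKernel a x = x^{-1/2} cosKernel a (1/x)`):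
  `Θ_c(t) = M (M t)^{-2} g_c(1/(M t))` with `g_c = sinKernel · cosKernel + i cosKernel · sinKernel`
  exponentially small at `∞` (`classTheta_eq_of_pos`, `isBigO_atTop_dualClassTheta`), whence
  `θ_ψ(t) = O(t^{-b})` for every `b` (`isBigO_nhdsGT_theta`) — a weight-one theta series is
  automatically cuspidal;
* so the Mellin transform `∫₀^∞ θ_ψ(t) t^{s-1} dt` is entire (`differentiable_mellin_theta`,
  Mathlib's `mellin_differentiableAt_of_isBigO_rpow`), and for `Re s > 3/2` it equals
  `π^{-s} Γ(s) ∑_x ψ(x) x (N(x)/M)^{-s}` by termwise integration (`hasSum_mellin_theta`, Mathlib's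
  `hasSum_mellin_pi_mul₀`; absolute convergence from `∑_{x ≠ 0} N(x)^{-r} < ∞`, `r > 1`,
  `summable_norm_rpow_neg`);
* regrouping the sum over `ℤ[i]` by norms gives the `L`-series of `c_ψ`
  (`LSeriesHasSum_coeff_of_hasSum`).

## References

* E. Hecke, *Eine neue Art von Zetafunktionen und ihre Beziehungen zur Verteilung der
  Primzahlen. II*, Math. Z. 6 (1920) 11–51, §9 (theta series with Grössencharakteren of an
  imaginary quadratic field).
* N. Koblitz, *Introduction to Elliptic Curves and Modular Forms*, GTM 97, 2nd ed. (1993),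
  Ch. II §5 (the Hecke `L`-series `L(χ̃_n, s) = L(E_n, s)`, its theta function, continuation and
  functional equation) — not held; cited from the catalogue entry and the use made of it in
  Ch. IV §4 (Tunnell's theorem).
* K. Ireland, M. Rosen, *A Classical Introduction to Modern Number Theory*, 2nd ed., GTM 84
  (1990), Ch. 18 §5 Theorem 6 (Hecke: `L(s, χ)` is entire; stated without proof, PDF p. 303) and
  §6 Theorem 7 (`L(E, s) = L(s, χ)` for `y² = x³ - Dx`, PDF p. 304) — held, read via
  `lit read book:ireland1982-classical-introduction-modern-number-theory --pages 303-304`.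
-/

noncomputable section

open Complex Real Set Filter Topology Asymptotics MeasureTheory HurwitzZeta

namespace Literature.NumberTheory.LFunctions

namespace GaussianTheta

local notation "ℤ[i]" => GaussianInt

/-- `ℤ[i]` is countable (it injects into `ℤ × ℤ`). [folklore] -/
instance : Countable ℤ[i] :=
  Function.Injective.countable (f := fun x : ℤ[i] ↦ (x.re, x.im))
    fun _ _ h ↦ Zsqrtd.ext (congrArg Prod.fst h) (congrArg Prod.snd h)

variable (M : ℕ) [NeZero M]

/-! ### Residue classes of `ℤ[i]` modulo `M` -/

/-- The class of `x = a + b i` modulo `M ℤ[i]`, as the pair `(a mod M, b mod M)`. [folklore] -/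
def cls (x : ℤ[i]) : ZMod M × ZMod M := ((x.re : ZMod M), (x.im : ZMod M))

/-- Parametrisation of the class `c` modulo `M ℤ[i]` by `ℤ × ℤ`:
`(m, m') ↦ (c₁ + M m) + (c₂ + M m') i`, with `0 ≤ c₁, c₂ < M` the canonical representatives.
[folklore] -/
def rep (c : ZMod M × ZMod M) (y : ℤ × ℤ) : ℤ[i] :=
  ⟨(c.1.val : ℤ) + M * y.1, (c.2.val : ℤ) + M * y.2⟩

omit [NeZero M] in
/-- Real part of `rep M c y`. [folklore] -/
@[simp] lemma rep_re (c : ZMod M × ZMod M) (y : ℤ × ℤ) :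
    (rep M c y).re = (c.1.val : ℤ) + M * y.1 := rfl

omit [NeZero M] in
/-- Imaginary part of `rep M c y`. [folklore] -/
@[simp] lemma rep_im (c : ZMod M × ZMod M) (y : ℤ × ℤ) :
    (rep M c y).im = (c.2.val : ℤ) + M * y.2 := rfl

omit [NeZero M] in
/-- `N(rep M c y) = (c₁ + M m)² + (c₂ + M m')²` (in `ℝ`). [folklore] -/
lemma norm_rep (c : ZMod M × ZMod M) (y : ℤ × ℤ) :
    (((rep M c y).norm : ℤ) : ℝ) =
      ((c.1.val : ℝ) + M * y.1) ^ 2 + ((c.2.val : ℝ) + M * y.2) ^ 2 := by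
  simp only [Zsqrtd.norm_def, rep_re, rep_im]
  push_cast
  ring

/-- The parametrisation of a class by `ℤ × ℤ` is injective (`M ≠ 0`). [folklore] -/
lemma rep_injective (c : ZMod M × ZMod M) : Function.Injective (rep M c) := by
  intro y y' h
  have hM : (M : ℤ) ≠ 0 := by exact_mod_cast (NeZero.ne M)
  have h1 := congrArg Zsqrtd.re h
  have h2 := congrArg Zsqrtd.im h
  simp only [rep_re, rep_im, add_right_inj] at h1 h2
  exact Prod.ext (mul_left_cancel₀ hM h1) (mul_left_cancel₀ hM h2)

/-- `rep M c y` lies in the class `c`. [folklore] -/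
lemma cls_rep (c : ZMod M × ZMod M) (y : ℤ × ℤ) : cls M (rep M c y) = c := by
  ext <;> simp [cls, rep]

/-- Every element of the class `c` is some `rep M c y` (Euclidean division by `M`). [folklore] -/
lemma exists_rep_eq {x : ℤ[i]} {c : ZMod M × ZMod M} (h : cls M x = c) : ∃ y, rep M c y = x := by
  have h1 : (x.re : ZMod M) = ((c.1.val : ℤ) : ZMod M) := by
    rw [Int.cast_natCast, ZMod.natCast_zmod_val]; exact congrArg Prod.fst h
  have h2 : (x.im : ZMod M) = ((c.2.val : ℤ) : ZMod M) := by
    rw [Int.cast_natCast, ZMod.natCast_zmod_val]; exact congrArg Prod.snd h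
  rw [ZMod.intCast_eq_intCast_iff_dvd_sub] at h1 h2
  obtain ⟨k₁, hk₁⟩ := h1
  obtain ⟨k₂, hk₂⟩ := h2
  refine ⟨(-k₁, -k₂), Zsqrtd.ext ?_ ?_⟩
  · simp only [rep_re]; linarith
  · simp only [rep_im]; linarith

/-- `rep M c y = rep M c 0 + M (m + m' i)`. [folklore] -/
lemma rep_eq_rep_zero_add (c : ZMod M × ZMod M) (y : ℤ × ℤ) :
    rep M c y = rep M c 0 + (M : ℤ[i]) * ⟨y.1, y.2⟩ := by
  refine Zsqrtd.ext ?_ ?_ <;> simp [rep]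

/-- The class `c` is exactly the range of `rep M c`. [folklore] -/
lemma range_rep (c : ZMod M × ZMod M) : Set.range (rep M c) = {x | cls M x = c} := by
  ext x
  constructor
  · rintro ⟨y, rfl⟩
    exact cls_rep M c y
  · exact fun h ↦ exists_rep_eq M h

/-! ### The theta function of a class and of a periodic coefficient -/

/-- The weight-one theta series of the class `c` modulo `M ℤ[i]`, as a function of `t > 0`:
`Θ_c(t) = ∑_{x ≡ c (M)} x e^{-π t N(x)/M}`, written through Mathlib's one-dimensional kernels
`oddKernel a x = ∑ (m + a) e^{-π (m+a)² x}` and `evenKernel a x = ∑ e^{-π (m+a)² x}` at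
`a = c₁/M`, `c₂/M` and `x = M t` (see `hasSum_classTheta`; Hecke 1920 §9). [folklore] -/
def classTheta (c : ZMod M × ZMod M) (t : ℝ) : ℂ :=
  (M : ℂ) * ((oddKernel (((c.1.val : ℝ) / M : ℝ) : UnitAddCircle) (M * t) : ℂ) *
      (evenKernel (((c.2.val : ℝ) / M : ℝ) : UnitAddCircle) (M * t) : ℂ) +
    I * ((evenKernel (((c.1.val : ℝ) / M : ℝ) : UnitAddCircle) (M * t) : ℂ) *
      (oddKernel (((c.2.val : ℝ) / M : ℝ) : UnitAddCircle) (M * t) : ℂ)))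

variable (ψ : ℤ[i] → ℂ)

/-- The weight-one theta function of a coefficient `ψ : ℤ[i] → ℂ` periodic modulo `M`:
`θ_ψ(t) = ∑_{x ∈ ℤ[i]} ψ(x) x e^{-π t N(x)/M}` (`hasSum_theta`), defined as the finite
combination `∑_c ψ(c) Θ_c(t)` of class theta series (Koblitz, Ch. II §5). [folklore] -/
def theta (t : ℝ) : ℂ := ∑ c : ZMod M × ZMod M, ψ (rep M c 0) * classTheta M c t

/-- The summand `ψ(x) x e^{-π t N(x)/M}` of the defining series of `θ_ψ`. [folklore] -/
def thetaTerm (t : ℝ) (x : ℤ[i]) : ℂ := ψ x * (x : ℂ) * (rexp (-π * t * (x.norm : ℝ) / M) : ℂ)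

/-- **`Θ_c(t) = ∑_{x ≡ c (M)} x e^{-π t N(x)/M}`** for `t > 0`: the class sum factors through
`ℤ × ℤ` into products of Mathlib's `oddKernel`/`evenKernel` series (Hecke 1920 §9). [folklore] -/
lemma hasSum_classTheta (c : ZMod M × ZMod M) {t : ℝ} (ht : 0 < t) :
    HasSum (fun y : ℤ × ℤ ↦ ((rep M c y : ℤ[i]) : ℂ) *
      (rexp (-π * t * ((rep M c y).norm : ℝ) / M) : ℂ)) (classTheta M c t) := by
  have hM : (0 : ℝ) < M := by exact_mod_cast Nat.pos_of_ne_zero (NeZero.ne M)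
  have hx : 0 < (M : ℝ) * t := mul_pos hM ht
  unfold classTheta
  set a : ℝ := (c.1.val : ℝ) / M with ha
  set b : ℝ := (c.2.val : ℝ) / M with hb
  -- the one-dimensional series and their absolute convergence
  let fO : ℝ → ℤ → ℂ := fun a' m ↦ (((m + a') * rexp (-π * (m + a') ^ 2 * (M * t)) : ℝ) : ℂ)
  let fE : ℝ → ℤ → ℂ := fun a' m ↦ ((rexp (-π * (m + a') ^ 2 * (M * t)) : ℝ) : ℂ)
  have hO (a' : ℝ) : HasSum (fO a') (oddKernel (a' : UnitAddCircle) (M * t) : ℂ) :=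
    Complex.hasSum_ofReal.mpr (hasSum_int_oddKernel a' hx)
  have hE (a' : ℝ) : HasSum (fE a') (evenKernel (a' : UnitAddCircle) (M * t) : ℂ) :=
    Complex.hasSum_ofReal.mpr (hasSum_int_evenKernel a' hx)
  have hnO (a' : ℝ) : Summable fun m : ℤ ↦ ‖fO a' m‖ := by
    refine (HurwitzKernelBounds.summable_f_int 1 a' hx).congr fun m ↦ ?_
    simp only [fO]
    rw [norm_real, Real.norm_eq_abs, abs_mul, abs_of_pos (Real.exp_pos _),
      HurwitzKernelBounds.f_int, pow_one]
  have hnE (a' : ℝ) : Summable fun m : ℤ ↦ ‖fE a' m‖ := by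
    refine (HurwitzKernelBounds.summable_f_int 0 a' hx).congr fun m ↦ ?_
    simp only [fE]
    rw [norm_real, Real.norm_eq_abs, abs_of_pos (Real.exp_pos _),
      HurwitzKernelBounds.f_int, pow_zero, one_mul]
  have hP₁ : HasSum (fun y : ℤ × ℤ ↦ fO a y.1 * fE b y.2)
      ((oddKernel (a : UnitAddCircle) (M * t) : ℂ) * (evenKernel (b : UnitAddCircle) (M * t) : ℂ)) :=
    (hO a).mul (hE b) (summable_mul_of_summable_norm (hnO a) (hnE b))
  have hP₂ : HasSum (fun y : ℤ × ℤ ↦ fE a y.1 * fO b y.2)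
      ((evenKernel (a : UnitAddCircle) (M * t) : ℂ) * (oddKernel (b : UnitAddCircle) (M * t) : ℂ)) :=
    (hE a).mul (hO b) (summable_mul_of_summable_norm (hnE a) (hnO b))
  have hS := (hP₁.add (hP₂.mul_left I)).mul_left (M : ℂ)
  refine hS.congr_fun fun y ↦ ?_
  simp only [fO, fE]
  have hMne : (M : ℝ) ≠ 0 := hM.ne'
  have h1 : (c.1.val : ℝ) + M * y.1 = M * (y.1 + a) := by rw [ha]; field_simp; ring
  have h2 : (c.2.val : ℝ) + M * y.2 = M * (y.2 + b) := by rw [hb]; field_simp; ring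
  have hexp : rexp (-π * t * (((rep M c y).norm : ℤ) : ℝ) / M) =
      rexp (-π * (y.1 + a) ^ 2 * (M * t)) * rexp (-π * (y.2 + b) ^ 2 * (M * t)) := by
    rw [← Real.exp_add, norm_rep, h1, h2]
    congr 1
    field_simp
    ring
  have hz : ((rep M c y : ℤ[i]) : ℂ) =
      (M : ℂ) * ((y.1 + a : ℝ) : ℂ) + (M : ℂ) * ((y.2 + b : ℝ) : ℂ) * I := by
    rw [GaussianInt.toComplex_def₂]
    apply Complex.ext
    · simp only [rep_re, add_re, mul_re, natCast_re, ofReal_re, natCast_im, ofReal_im, mul_zero,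
        sub_zero, I_re, mul_im, I_im, zero_add]
      push_cast
      linarith [h1]
    · simp only [rep_im, add_im, mul_im, natCast_re, ofReal_im, natCast_im, ofReal_re, mul_zero,
        zero_mul, add_zero, I_re, I_im, mul_re, mul_one, sub_zero, zero_add]
      push_cast
      linarith [h2]
  rw [hexp, hz]
  push_cast
  ring

/-- **`θ_ψ` is the series `∑_{x ∈ ℤ[i]} ψ(x) x e^{-π t N(x)/M}`** for `ψ` periodic modulo `M`
and `t > 0` (grouping the absolutely convergent double series by classes modulo `M`; Hecke,
*Mathematische Werke* no. 14 (1920) §9; Koblitz, *Introduction to Elliptic Curves and Modular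
Forms*, Ch. II §5, proof of the Theorem). [folklore] -/
theorem hasSum_theta (hψ : ∀ x y : ℤ[i], ψ (x + M * y) = ψ x) {t : ℝ} (ht : 0 < t) :
    HasSum (thetaTerm M ψ t) (theta M ψ t) := by
  classical
  have key : ∀ c : ZMod M × ZMod M,
      HasSum (fun x ↦ if cls M x = c then thetaTerm M ψ t x else 0)
        (ψ (rep M c 0) * classTheta M c t) := by
    intro c
    have hoff : ∀ x ∉ Set.range (rep M c),
        (fun x ↦ if cls M x = c then thetaTerm M ψ t x else 0) x = 0 := by
      intro x hx
      rw [range_rep] at hx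
      exact if_neg hx
    refine ((rep_injective M c).hasSum_iff hoff).mp ?_
    have heq : ((fun x ↦ if cls M x = c then thetaTerm M ψ t x else 0) ∘ rep M c) =
        fun y ↦ ψ (rep M c 0) * (((rep M c y : ℤ[i]) : ℂ) *
          (rexp (-π * t * ((rep M c y).norm : ℝ) / M) : ℂ)) := by
      funext y
      simp only [Function.comp_apply, cls_rep, if_true, thetaTerm]
      rw [rep_eq_rep_zero_add M c y, hψ, ← rep_eq_rep_zero_add M c y]
      ring
    rw [heq]
    exact (hasSum_classTheta M c ht).mul_left _
  have := hasSum_sum (s := (Finset.univ : Finset (ZMod M × ZMod M))) fun c _ ↦ key c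
  refine this.congr_fun fun x ↦ ?_
  simp only [Finset.sum_ite_eq, Finset.mem_univ, if_true]

/-- A coefficient periodic modulo `M` is bounded (it takes finitely many values). [folklore] -/
theorem norm_le_of_periodic (hψ : ∀ x y : ℤ[i], ψ (x + M * y) = ψ x) (x : ℤ[i]) :
    ‖ψ x‖ ≤ ∑ c : ZMod M × ZMod M, ‖ψ (rep M c 0)‖ := by
  obtain ⟨y, hy⟩ := exists_rep_eq M (c := cls M x) rfl
  rw [← hy, rep_eq_rep_zero_add, hψ]
  exact Finset.single_le_sum (f := fun c ↦ ‖ψ (rep M c 0)‖) (fun _ _ ↦ norm_nonneg _)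
    (Finset.mem_univ (cls M x))

/-! ### Convergence of `∑ N(x)^{-r}` over `ℤ[i]` for `r > 1` -/

omit [NeZero M] in
/-- `∑_{x ∈ ℤ[i], x ≠ 0} N(x)^{-r}` converges for `r > 1` (the Dedekind zeta function of `ℚ(i)`
converges for `Re s > 1`; elementary comparison `a² + b² ≥ |a| |b|` with `(∑ |a|^{-r})²`).
The term at `x = 0` is the junk value `0 ^ (-r) = 0`. [folklore] -/
theorem summable_norm_rpow_neg {r : ℝ} (hr : 1 < r) :
    Summable fun x : ℤ[i] ↦ ((x.norm : ℤ) : ℝ) ^ (-r) := by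
  -- transfer to `ℤ × ℤ`
  let e : ℤ × ℤ ≃ ℤ[i] :=
    { toFun := fun p ↦ ⟨p.1, p.2⟩
      invFun := fun x ↦ (x.re, x.im)
      left_inv := fun p ↦ rfl
      right_inv := fun x ↦ rfl }
  rw [← e.summable_iff]
  -- the dominating product series
  let u : ℤ → ℝ := fun n ↦ |(n : ℝ)| ^ (-r) + if n = 0 then 1 else 0
  have hu_nonneg : ∀ n, 0 ≤ u n := fun n ↦
    add_nonneg (Real.rpow_nonneg (abs_nonneg _) _) (by split_ifs <;> norm_num)
  have hu_one : ∀ n : ℤ, n ≠ 0 → |(n : ℝ)| ^ (-r) ≤ u n := fun n hn ↦ by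
    simp [u, hn]
  have hu_ge_one_iff : ∀ n : ℤ, n ≠ 0 → (1 : ℝ) ≤ |(n : ℝ)| := fun n hn ↦ by
    rw [← Int.cast_abs]; exact_mod_cast Int.one_le_abs hn
  have hsu : Summable u :=
    (summable_abs_int_rpow hr).add (summable_of_ne_finset_zero (s := {0}) (by
      intro n hn; rw [Finset.mem_singleton] at hn; exact if_neg hn))
  have hprod : Summable fun p : ℤ × ℤ ↦ u p.1 * u p.2 := by
    have h1 : Summable fun n ↦ ‖u n‖ := hsu.norm
    simpa using (summable_mul_of_summable_norm (f := u) (g := u) h1 h1)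
  refine Summable.of_nonneg_of_le (fun p ↦ Real.rpow_nonneg ?_ _) (fun p ↦ ?_) hprod
  · exact_mod_cast GaussianInt.norm_nonneg _
  · -- the comparison `(a² + b²)^{-r} ≤ u a * u b`
    change (((Zsqrtd.norm ⟨p.1, p.2⟩ : ℤ) : ℝ)) ^ (-r) ≤ u p.1 * u p.2
    have hn : (((Zsqrtd.norm (⟨p.1, p.2⟩ : ℤ[i]) : ℤ) : ℝ)) = (p.1 : ℝ) ^ 2 + (p.2 : ℝ) ^ 2 := by
      simp only [Zsqrtd.norm_def]; push_cast; ring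
    rw [hn]
    rcases eq_or_ne p.1 0 with h1 | h1
    · rcases eq_or_ne p.2 0 with h2 | h2
      · simp only [h1, h2, Int.cast_zero]
        rw [show (0 : ℝ) ^ 2 + 0 ^ 2 = 0 by norm_num, Real.zero_rpow (by linarith)]
        exact mul_nonneg (hu_nonneg 0) (hu_nonneg 0)
      · -- `(b²)^{-r} = |b|^{-2r} ≤ |b|^{-r} ≤ u 0 * u b`
        have hb1 : (1 : ℝ) ≤ |(p.2 : ℝ)| := hu_ge_one_iff _ h2
        have hu0 : (1 : ℝ) ≤ u 0 := by simp [u, Real.zero_rpow (by linarith : -r ≠ 0)]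
        calc ((p.1 : ℝ) ^ 2 + (p.2 : ℝ) ^ 2) ^ (-r) = (|(p.2 : ℝ)| ^ (2 : ℝ)) ^ (-r) := by
              rw [h1, Int.cast_zero, zero_pow two_ne_zero, zero_add, Real.rpow_two, sq_abs]
          _ = |(p.2 : ℝ)| ^ (-(2 * r)) := by
              rw [← Real.rpow_mul (abs_nonneg _)]; ring_nf
          _ ≤ |(p.2 : ℝ)| ^ (-r) :=
              Real.rpow_le_rpow_of_exponent_le hb1 (by linarith)
          _ ≤ u p.2 := hu_one _ h2
          _ ≤ u 0 * u p.2 := le_mul_of_one_le_left (hu_nonneg _) hu0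
          _ = u p.1 * u p.2 := by rw [h1]
    · rcases eq_or_ne p.2 0 with h2 | h2
      · have ha1 : (1 : ℝ) ≤ |(p.1 : ℝ)| := hu_ge_one_iff _ h1
        have hu0 : (1 : ℝ) ≤ u 0 := by simp [u, Real.zero_rpow (by linarith : -r ≠ 0)]
        calc ((p.1 : ℝ) ^ 2 + (p.2 : ℝ) ^ 2) ^ (-r) = (|(p.1 : ℝ)| ^ (2 : ℝ)) ^ (-r) := by
              rw [h2, Int.cast_zero, zero_pow two_ne_zero, add_zero, Real.rpow_two, sq_abs]
          _ = |(p.1 : ℝ)| ^ (-(2 * r)) := by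
              rw [← Real.rpow_mul (abs_nonneg _)]; ring_nf
          _ ≤ |(p.1 : ℝ)| ^ (-r) :=
              Real.rpow_le_rpow_of_exponent_le ha1 (by linarith)
          _ ≤ u p.1 := hu_one _ h1
          _ ≤ u p.1 * u 0 := le_mul_of_one_le_right (hu_nonneg _) hu0
          _ = u p.1 * u p.2 := by rw [h2]
      · -- both nonzero: `a² + b² ≥ |a| |b|`
        have ha1 : (1 : ℝ) ≤ |(p.1 : ℝ)| := hu_ge_one_iff _ h1
        have hb1 : (1 : ℝ) ≤ |(p.2 : ℝ)| := hu_ge_one_iff _ h2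
        have hab : |(p.1 : ℝ)| * |(p.2 : ℝ)| ≤ (p.1 : ℝ) ^ 2 + (p.2 : ℝ) ^ 2 := by
          nlinarith [sq_nonneg (|(p.1 : ℝ)| - |(p.2 : ℝ)|), sq_abs (p.1 : ℝ), sq_abs (p.2 : ℝ),
            abs_nonneg (p.1 : ℝ), abs_nonneg (p.2 : ℝ)]
        have hpos : 0 < |(p.1 : ℝ)| * |(p.2 : ℝ)| := by positivity
        calc ((p.1 : ℝ) ^ 2 + (p.2 : ℝ) ^ 2) ^ (-r) ≤ (|(p.1 : ℝ)| * |(p.2 : ℝ)|) ^ (-r) :=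
              Real.rpow_le_rpow_of_nonpos hpos hab (by linarith)
          _ = |(p.1 : ℝ)| ^ (-r) * |(p.2 : ℝ)| ^ (-r) :=
              Real.mul_rpow (abs_nonneg _) (abs_nonneg _)
          _ ≤ u p.1 * u p.2 :=
              mul_le_mul (hu_one _ h1) (hu_one _ h2) (Real.rpow_nonneg (abs_nonneg _) _)
                (hu_nonneg _)

/-! ### The Dirichlet series: absolute convergence for `Re s > 3/2` and the Mellin identity -/

/-- `‖x‖ = N(x)^{1/2}` for a Gaussian integer viewed in `ℂ`. [folklore] -/
lemma norm_toComplex (x : ℤ[i]) : ‖(x : ℂ)‖ = (((x.norm : ℤ) : ℝ)) ^ (1 / 2 : ℝ) := by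
  rw [Complex.norm_def, Real.sqrt_eq_rpow, GaussianInt.intCast_real_norm]

/-- Absolute convergence of `∑ ψ(x) x (N(x)/M)^{-σ}` for `σ > 3/2` and bounded (here: periodic)
`ψ` (comparison with `∑ N(x)^{-(σ - 1/2)}`, `summable_norm_rpow_neg`). [folklore] -/
theorem summable_norm_div_rpow (hψ : ∀ x y : ℤ[i], ψ (x + M * y) = ψ x) {σ : ℝ}
    (hσ : 3 / 2 < σ) :
    Summable fun x : ℤ[i] ↦ ‖ψ x * (x : ℂ)‖ / ((((x.norm : ℤ) : ℝ)) / M) ^ σ := by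
  have hM : (0 : ℝ) < M := by exact_mod_cast Nat.pos_of_ne_zero (NeZero.ne M)
  set B : ℝ := ∑ c : ZMod M × ZMod M, ‖ψ (rep M c 0)‖ with hB
  have hB0 : 0 ≤ B := Finset.sum_nonneg fun _ _ ↦ norm_nonneg _
  have hdom := (summable_norm_rpow_neg (r := σ - 1 / 2) (by linarith)).mul_left (B * (M : ℝ) ^ σ)
  refine Summable.of_nonneg_of_le (fun x ↦ ?_) (fun x ↦ ?_) hdom
  · exact div_nonneg (norm_nonneg _) (Real.rpow_nonneg
      (div_nonneg (by exact_mod_cast GaussianInt.norm_nonneg x) hM.le) _)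
  · have hN0 : (0 : ℝ) ≤ ((x.norm : ℤ) : ℝ) := by exact_mod_cast GaussianInt.norm_nonneg x
    rcases hN0.eq_or_lt with hN | hN
    · -- `x = 0`
      have hx : x = 0 := by
        rw [← GaussianInt.norm_eq_zero]; exact_mod_cast hN.symm
      subst hx
      simp only [map_zero, mul_zero, norm_zero, zero_div]
      exact mul_nonneg (mul_nonneg hB0 (Real.rpow_nonneg hM.le _)) (Real.rpow_nonneg hN0 _)
    · rw [norm_mul, norm_toComplex, Real.div_rpow hN0 hM.le, div_div_eq_mul_div]
      rw [div_le_iff₀ (Real.rpow_pos_of_pos hN _)]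
      calc ‖ψ x‖ * (((x.norm : ℤ) : ℝ)) ^ (1 / 2 : ℝ) * (M : ℝ) ^ σ
          ≤ B * (((x.norm : ℤ) : ℝ)) ^ (1 / 2 : ℝ) * (M : ℝ) ^ σ := by
            gcongr
            exact norm_le_of_periodic M ψ hψ x
        _ = B * (M : ℝ) ^ σ * (((x.norm : ℤ) : ℝ)) ^ (-(σ - 1 / 2)) *
              (((x.norm : ℤ) : ℝ)) ^ σ := by
            rw [mul_assoc (B * (M : ℝ) ^ σ), ← Real.rpow_add hN]
            ring_nf

/-- **Mellin transform of `θ_ψ`**: for `Re s > 3/2`,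
`∫₀^∞ θ_ψ(t) t^{s-1} dt = π^{-s} Γ(s) ∑_x ψ(x) x (N(x)/M)^{-s}` (termwise integration of the
absolutely convergent theta series; Hecke 1920 §9, Koblitz Ch. II §5). [folklore] -/
theorem hasSum_mellin_theta (hψ : ∀ x y : ℤ[i], ψ (x + M * y) = ψ x) {s : ℂ}
    (hs : 3 / 2 < s.re) :
    HasSum (fun x : ℤ[i] ↦ (π : ℂ) ^ (-s) * Complex.Gamma s * (ψ x * (x : ℂ)) /
      (((((x.norm : ℤ) : ℝ)) / M : ℝ) : ℂ) ^ s) (mellin (theta M ψ) s) := by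
  have hM : (0 : ℝ) < M := by exact_mod_cast Nat.pos_of_ne_zero (NeZero.ne M)
  refine hasSum_mellin_pi_mul₀ (fun x ↦ div_nonneg (by exact_mod_cast GaussianInt.norm_nonneg x)
    hM.le) (by linarith) (fun t ht ↦ ?_) (summable_norm_div_rpow M ψ hψ hs)
  refine (hasSum_theta M ψ hψ ht).congr_fun fun x ↦ ?_
  split_ifs with h
  · have hx : x = 0 := by
      rw [div_eq_zero_iff, or_iff_left hM.ne'] at h
      rw [← GaussianInt.norm_eq_zero]; exact_mod_cast h
    simp [thetaTerm, hx]
  · simp only [thetaTerm]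
    congr 2
    ring_nf

/-! ### Regrouping by norms: the `L`-series `∑ c(m) m^{-s}` -/

/-- The (finite) set of Gaussian integers of norm `m`. [folklore] -/
def normEq (m : ℕ) : Finset ℤ[i] :=
  (((Finset.Icc (-(m : ℤ)) m) ×ˢ (Finset.Icc (-(m : ℤ)) m)).image
    fun p : ℤ × ℤ ↦ (⟨p.1, p.2⟩ : ℤ[i])).filter fun x ↦ x.norm = m

omit [NeZero M] in
/-- `x ∈ normEq m ↔ N(x) = m` (`|re x|, |im x| ≤ N(x)`). [folklore] -/
lemma mem_normEq {m : ℕ} {x : ℤ[i]} : x ∈ normEq m ↔ x.norm = m := by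
  simp only [normEq, Finset.mem_filter, Finset.mem_image, Finset.mem_product, Finset.mem_Icc,
    Prod.exists, and_iff_right_iff_imp]
  intro h
  refine ⟨x.re, x.im, ⟨?_, ?_⟩, rfl⟩
  · have h1 : (x.re.natAbs : ℤ) ≤ m := by
      rw [← h, Zsqrtd.norm_def]
      nlinarith [Int.natAbs_le_self_sq x.re, sq_nonneg x.im]
    constructor <;> omega
  · have h1 : (x.im.natAbs : ℤ) ≤ m := by
      rw [← h, Zsqrtd.norm_def]
      nlinarith [Int.natAbs_le_self_sq x.im, sq_nonneg x.re]
    constructor <;> omega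

omit [NeZero M] in
/-- Only `0` has norm `0`. [folklore] -/
lemma normEq_zero : normEq 0 = {0} := by
  ext x
  rw [mem_normEq, Finset.mem_singleton, Nat.cast_zero, GaussianInt.norm_eq_zero]

/-- The coefficients of the `L`-series of `θ_ψ`: `c_ψ(m) = ∑_{N(x) = m} ψ(x) x`. [folklore] -/
def coeff (m : ℕ) : ℂ := ∑ x ∈ normEq m, ψ x * (x : ℂ)

omit [NeZero M] in
/-- `c_ψ(0) = 0`. [folklore] -/
@[simp] lemma coeff_zero : coeff ψ 0 = 0 := by
  simp [coeff, normEq_zero]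

omit [NeZero M] in
/-- Regrouping an absolutely convergent series over `ℤ[i]` by norms gives an `L`-series:
`∑_x ψ(x) x N(x)^{-s} = ∑_m c_ψ(m) m^{-s}`. [folklore] -/
theorem LSeriesHasSum_coeff_of_hasSum {s A : ℂ}
    (h : HasSum (fun x : ℤ[i] ↦ ψ x * (x : ℂ) / (((x.norm : ℤ) : ℂ)) ^ s) A) :
    LSeriesHasSum (coeff ψ) s A := by
  have h2 := h.tsum_fiberwise fun x : ℤ[i] ↦ x.norm.natAbs
  refine h2.congr_fun fun m ↦ ?_
  have hset : ((fun x : ℤ[i] ↦ x.norm.natAbs) ⁻¹' {m}) = ↑(normEq m) := by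
    ext x
    simp only [Set.mem_preimage, Set.mem_singleton_iff, Finset.mem_coe, mem_normEq]
    have := GaussianInt.norm_nonneg x
    omega
  rw [tsum_congr_set_coe (fun x : ℤ[i] ↦ ψ x * (x : ℂ) / (((x.norm : ℤ) : ℂ)) ^ s) hset,
    Finset.tsum_subtype' (normEq m) (fun x : ℤ[i] ↦ ψ x * (x : ℂ) / (((x.norm : ℤ) : ℂ)) ^ s)]
  rw [LSeries.term]
  split_ifs with hm
  · subst hm
    simp [normEq_zero]
  · rw [coeff, Finset.sum_div]
    refine Finset.sum_congr rfl fun x hx ↦ ?_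
    rw [mem_normEq] at hx
    rw [hx]
    norm_cast

/-! ### Decay of `θ_ψ` at `∞` and at `0`; the Mellin transform is entire -/

omit [NeZero M] in
/-- Decay transfer: if `g = O(e^{-p u})` as `u → ∞` then `t^{-k} g(1/(M t)) = O(t^{-b})` as
`t → 0⁺`, for every `b`. [folklore] -/
lemma isBigO_nhdsGT_zero_of_isBigO_atTop {g : ℝ → ℂ} {p : ℝ} (hp : 0 < p)
    (hg : g =O[atTop] fun u ↦ rexp (-p * u)) {M' : ℝ} (hM' : 0 < M') (k b : ℝ) :
    (fun t : ℝ ↦ ((t ^ (-k) : ℝ) : ℂ) * g (1 / (M' * t))) =O[𝓝[>] 0] fun t ↦ t ^ (-b) := by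
  have h1 : g =O[atTop] fun u ↦ u ^ (-(k - b)) :=
    hg.trans (isLittleO_exp_neg_mul_rpow_atTop hp _).isBigO
  have hφ : Tendsto (fun t : ℝ ↦ 1 / (M' * t)) (𝓝[>] 0) atTop := by
    have : Tendsto (fun t : ℝ ↦ t⁻¹ * M'⁻¹) (𝓝[>] 0) atTop :=
      tendsto_inv_nhdsGT_zero.atTop_mul_const (inv_pos.mpr hM')
    refine this.congr fun t ↦ ?_
    rw [one_div, mul_inv, mul_comm]
  have h2 := h1.comp_tendsto hφ
  have h0 : (fun t : ℝ ↦ ((t ^ (-k) : ℝ) : ℂ)) =O[𝓝[>] 0] fun t : ℝ ↦ t ^ (-k) :=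
    Complex.isBigO_ofReal_left.mpr (isBigO_refl _ _)
  refine (h0.mul h2).trans ?_
  have h4 : (fun t : ℝ ↦ t ^ (-k) * ((fun u : ℝ ↦ u ^ (-(k - b))) ∘ fun t ↦ 1 / (M' * t)) t)
      =ᶠ[𝓝[>] 0] fun t ↦ M' ^ (k - b) * t ^ (-b) := by
    filter_upwards [self_mem_nhdsWithin] with t (ht : 0 < t)
    simp only [Function.comp_apply]
    rw [one_div, Real.inv_rpow (mul_pos hM' ht).le, ← Real.rpow_neg (mul_pos hM' ht).le, neg_neg,
      Real.mul_rpow hM'.le ht.le]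
    have : t ^ (-k) * t ^ (k - b) = t ^ (-b) := by
      rw [← Real.rpow_add ht]; ring_nf
    calc t ^ (-k) * (M' ^ (k - b) * t ^ (k - b))
        = M' ^ (k - b) * (t ^ (-k) * t ^ (k - b)) := by ring
      _ = _ := by rw [this]
  exact h4.isBigO.trans (isBigO_const_mul_self _ _ _)

/-- The combination of dual kernels entering `Θ_c(1/t)`:
`g_c(u) = sinKernel(c₁/M)(u) cosKernel(c₂/M)(u) + i cosKernel(c₁/M)(u) sinKernel(c₂/M)(u)`.
[folklore] -/
def dualClassTheta (c : ZMod M × ZMod M) (u : ℝ) : ℂ :=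
  (sinKernel (((c.1.val : ℝ) / M : ℝ) : UnitAddCircle) u : ℂ) *
      (cosKernel (((c.2.val : ℝ) / M : ℝ) : UnitAddCircle) u : ℂ) +
    I * ((cosKernel (((c.1.val : ℝ) / M : ℝ) : UnitAddCircle) u : ℂ) *
      (sinKernel (((c.2.val : ℝ) / M : ℝ) : UnitAddCircle) u : ℂ))

omit [NeZero M] in
/-- `cosKernel a = O(1)` at `∞`. [folklore] -/
lemma isBigO_atTop_cosKernel_one (a : UnitAddCircle) :
    (fun u ↦ (cosKernel a u : ℂ)) =O[atTop] fun _ ↦ (1 : ℝ) := by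
  obtain ⟨p, hp, h⟩ := isBigO_atTop_cosKernel_sub a
  rw [Complex.isBigO_ofReal_left]
  have h1 : (fun u ↦ cosKernel a u - 1) =O[atTop] fun _ ↦ (1 : ℝ) := by
    refine h.trans (IsBigO.of_bound 1 ?_)
    filter_upwards [eventually_ge_atTop 0] with u hu
    rw [Real.norm_eq_abs, abs_of_pos (Real.exp_pos _), norm_one, one_mul, Real.exp_le_one_iff]
    nlinarith
  simpa using h1.add (isBigO_const_const (1 : ℝ) one_ne_zero atTop)

omit [NeZero M] in
/-- Exponential decay of the dual combination `g_c` at `∞` (from that of `sinKernel`,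
`cosKernel = O(1)`). [folklore] -/
lemma isBigO_atTop_dualClassTheta (c : ZMod M × ZMod M) :
    ∃ p, 0 < p ∧ dualClassTheta M c =O[atTop] fun u ↦ rexp (-p * u) := by
  have hS (a : UnitAddCircle) : ∃ p, 0 < p ∧
      (fun u ↦ (sinKernel a u : ℂ)) =O[atTop] fun u ↦ rexp (-p * u) := by
    obtain ⟨p, hp, h⟩ := isBigO_atTop_sinKernel a
    exact ⟨p, hp, Complex.isBigO_ofReal_left.mpr h⟩
  obtain ⟨p₁, hp₁, h₁⟩ := hS (((c.1.val : ℝ) / M : ℝ) : UnitAddCircle)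
  obtain ⟨p₂, hp₂, h₂⟩ := hS (((c.2.val : ℝ) / M : ℝ) : UnitAddCircle)
  refine ⟨min p₁ p₂, lt_min hp₁ hp₂, ?_⟩
  have hA := (h₁.mul (isBigO_atTop_cosKernel_one
    (((c.2.val : ℝ) / M : ℝ) : UnitAddCircle))).trans
    ((HurwitzKernelBounds.isBigO_exp_neg_mul_of_le (min_le_left p₁ p₂)).congr_left
      fun u ↦ (mul_one _).symm)
  have hB := ((isBigO_atTop_cosKernel_one
    (((c.1.val : ℝ) / M : ℝ) : UnitAddCircle)).mul h₂).trans
    ((HurwitzKernelBounds.isBigO_exp_neg_mul_of_le (min_le_right p₁ p₂)).congr_left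
      fun u ↦ (one_mul _).symm)
  exact hA.add (hB.const_mul_left I)

omit [NeZero M] in
/-- `x^{-3/2} · x^{-1/2} = x^{-2}` for `x > 0`. [folklore] -/
lemma one_div_rpow_mul_one_div_rpow {x : ℝ} (hx : 0 < x) :
    1 / x ^ (3 / 2 : ℝ) * (1 / x ^ (1 / 2 : ℝ)) = x ^ (-(2 : ℝ)) := by
  rw [one_div, one_div, ← Real.rpow_neg hx.le, ← Real.rpow_neg hx.le, ← Real.rpow_add hx]
  norm_num

/-- **Theta inversion for `Θ_c`**: for `t > 0`, `Θ_c(t) = M (M t)^{-2} g_c(1/(M t))`, from the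
functional equations of Mathlib's `oddKernel`/`evenKernel` (Poisson summation; Hecke 1920 §9,
Koblitz Ch. II §5). [folklore] -/
theorem classTheta_eq_of_pos (c : ZMod M × ZMod M) {t : ℝ} (ht : 0 < t) :
    classTheta M c t =
      (M : ℂ) * ((((M : ℝ) * t) ^ (-(2 : ℝ)) : ℝ) : ℂ) * dualClassTheta M c (1 / (M * t)) := by
  have hM : (0 : ℝ) < M := by exact_mod_cast Nat.pos_of_ne_zero (NeZero.ne M)
  have hx : 0 < (M : ℝ) * t := mul_pos hM ht
  unfold classTheta dualClassTheta
  rw [oddKernel_functional_equation (((c.1.val : ℝ) / M : ℝ) : UnitAddCircle),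
    evenKernel_functional_equation (((c.1.val : ℝ) / M : ℝ) : UnitAddCircle),
    oddKernel_functional_equation (((c.2.val : ℝ) / M : ℝ) : UnitAddCircle),
    evenKernel_functional_equation (((c.2.val : ℝ) / M : ℝ) : UnitAddCircle),
    ← one_div_rpow_mul_one_div_rpow hx]
  push_cast
  ring

/-- Decay of `Θ_c` at `0⁺`: `Θ_c(t) = O(t^{-b})` for every `b`. [folklore] -/
theorem isBigO_nhdsGT_classTheta (c : ZMod M × ZMod M) (b : ℝ) :
    classTheta M c =O[𝓝[>] 0] fun t : ℝ ↦ t ^ (-b) := by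
  have hM : (0 : ℝ) < M := by exact_mod_cast Nat.pos_of_ne_zero (NeZero.ne M)
  obtain ⟨p, hp, hg⟩ := isBigO_atTop_dualClassTheta M c
  have h1 := isBigO_nhdsGT_zero_of_isBigO_atTop hp hg hM 2 b
  have h2 := (h1.const_mul_left ((((M : ℝ) ^ (-(2 : ℝ)) : ℝ) : ℂ))).const_mul_left (M : ℂ)
  refine h2.congr' ?_ EventuallyEq.rfl
  filter_upwards [self_mem_nhdsWithin] with t (ht : 0 < t)
  rw [classTheta_eq_of_pos M c ht, Real.mul_rpow hM.le ht.le]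
  push_cast
  ring

/-- Decay of `θ_ψ` at `0⁺`: `θ_ψ(t) = O(t^{-b})` for every `b` (a weight-one theta series has no
constant term on either side of the inversion). [folklore] -/
theorem isBigO_nhdsGT_theta (b : ℝ) : theta M ψ =O[𝓝[>] 0] fun t : ℝ ↦ t ^ (-b) := by
  unfold theta
  exact IsBigO.sum fun c _ ↦ (isBigO_nhdsGT_classTheta M c b).const_mul_left _

/-- Decay of `Θ_c` at `∞`: `Θ_c(t) = O(t^{-A})` for every `A` (indeed exponential). [folklore] -/
theorem isBigO_atTop_classTheta (c : ZMod M × ZMod M) (A : ℝ) :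
    classTheta M c =O[atTop] fun t : ℝ ↦ t ^ (-A) := by
  have hM : (0 : ℝ) < M := by exact_mod_cast Nat.pos_of_ne_zero (NeZero.ne M)
  have hten : Tendsto (fun t : ℝ ↦ (M : ℝ) * t) atTop atTop :=
    Tendsto.const_mul_atTop hM tendsto_id
  have hO (a : UnitAddCircle) :
      (fun t : ℝ ↦ (oddKernel a (M * t) : ℂ)) =O[atTop] fun t : ℝ ↦ t ^ (-A) := by
    obtain ⟨p, hp, h⟩ := isBigO_atTop_oddKernel a
    rw [Complex.isBigO_ofReal_left]
    refine (h.comp_tendsto hten).trans ?_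
    have h' := (isLittleO_exp_neg_mul_rpow_atTop (mul_pos hp hM) (-A)).isBigO
    refine (IsBigO.of_bound 1 ?_).trans h'
    filter_upwards with t
    simp only [Function.comp_apply, one_mul, Real.norm_eq_abs, abs_of_pos (Real.exp_pos _)]
    exact le_of_eq (by ring_nf)
  have hE (a : UnitAddCircle) :
      (fun t : ℝ ↦ (evenKernel a (M * t) : ℂ)) =O[atTop] fun _ : ℝ ↦ (1 : ℝ) := by
    obtain ⟨p, hp, h⟩ := isBigO_atTop_evenKernel_sub a
    rw [Complex.isBigO_ofReal_left]
    have h1 : (fun x ↦ evenKernel a x - if a = 0 then 1 else 0) =O[atTop] fun _ ↦ (1 : ℝ) := by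
      refine h.trans (IsBigO.of_bound 1 ?_)
      filter_upwards [eventually_ge_atTop 0] with u hu
      rw [Real.norm_eq_abs, abs_of_pos (Real.exp_pos _), norm_one, one_mul, Real.exp_le_one_iff]
      nlinarith
    have h2 : (fun x ↦ evenKernel a x) =O[atTop] fun _ ↦ (1 : ℝ) := by
      simpa using h1.add (isBigO_const_const (if a = 0 then (1 : ℝ) else 0) one_ne_zero atTop)
    exact h2.comp_tendsto hten
  have hP₁ (a a' : UnitAddCircle) : (fun t : ℝ ↦ (oddKernel a (M * t) : ℂ) *
      (evenKernel a' (M * t) : ℂ)) =O[atTop] fun t : ℝ ↦ t ^ (-A) := by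
    simpa using (hO a).mul (hE a')
  have hP₂ (a a' : UnitAddCircle) : (fun t : ℝ ↦ (evenKernel a (M * t) : ℂ) *
      (oddKernel a' (M * t) : ℂ)) =O[atTop] fun t : ℝ ↦ t ^ (-A) := by
    simpa using (hE a).mul (hO a')
  unfold classTheta
  exact ((hP₁ _ _).add ((hP₂ _ _).const_mul_left I)).const_mul_left _

/-- Decay of `θ_ψ` at `∞`: `θ_ψ(t) = O(t^{-A})` for every `A`. [folklore] -/
theorem isBigO_atTop_theta (A : ℝ) : theta M ψ =O[atTop] fun t : ℝ ↦ t ^ (-A) := by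
  unfold theta
  exact IsBigO.sum fun c _ ↦ (isBigO_atTop_classTheta M c A).const_mul_left _

/-- `Θ_c` is continuous on `(0, ∞)`. [folklore] -/
theorem continuousOn_classTheta (c : ZMod M × ZMod M) : ContinuousOn (classTheta M c) (Ioi 0) := by
  have hM : (0 : ℝ) < M := by exact_mod_cast Nat.pos_of_ne_zero (NeZero.ne M)
  have hmaps : MapsTo (fun t : ℝ ↦ (M : ℝ) * t) (Ioi 0) (Ioi 0) := fun t ht ↦ mul_pos hM ht
  have hlin : ContinuousOn (fun t : ℝ ↦ (M : ℝ) * t) (Ioi 0) :=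
    (continuous_const.mul continuous_id).continuousOn
  have hO (a : UnitAddCircle) : ContinuousOn (fun t : ℝ ↦ (oddKernel a (M * t) : ℂ)) (Ioi 0) :=
    continuous_ofReal.comp_continuousOn ((continuousOn_oddKernel a).comp hlin hmaps)
  have hE (a : UnitAddCircle) : ContinuousOn (fun t : ℝ ↦ (evenKernel a (M * t) : ℂ)) (Ioi 0) :=
    continuous_ofReal.comp_continuousOn ((continuousOn_evenKernel a).comp hlin hmaps)
  unfold classTheta
  exact continuousOn_const.mul (((hO _).mul (hE _)).add (continuousOn_const.mul ((hE _).mul (hO _))))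

/-- `θ_ψ` is continuous on `(0, ∞)`. [folklore] -/
theorem continuousOn_theta : ContinuousOn (theta M ψ) (Ioi 0) := by
  unfold theta
  exact continuousOn_finsetSum _ fun c _ ↦ continuousOn_const.mul (continuousOn_classTheta M c)

/-- **The Mellin transform of `θ_ψ` is entire** (decay `O(t^{-A})` at `∞` and `O(t^{-b})` at
`0⁺` for all `A`, `b`). [folklore] -/
theorem differentiable_mellin_theta : Differentiable ℂ (mellin (theta M ψ)) := fun s ↦
  mellin_differentiableAt_of_isBigO_rpow (a := s.re + 1) (b := s.re - 1)
    ((continuousOn_theta M ψ).locallyIntegrableOn measurableSet_Ioi)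
    (isBigO_atTop_theta M ψ _) (by linarith) (isBigO_nhdsGT_theta M ψ _) (by linarith)

/-! ### The entire continuation of `∑ c_ψ(m) m^{-s}` -/

/-- The entire function `(π/M)^s Γ(s)^{-1} ∫₀^∞ θ_ψ(t) t^{s-1} dt`, which for `Re s > 3/2` is the
`L`-series `∑_{x ∈ ℤ[i]} ψ(x) x N(x)^{-s} = ∑_m c_ψ(m) m^{-s}` (`thetaLFunction_eq_LSeries`;
Hecke 1920 §9; Koblitz Ch. II §5, Theorem). [folklore] -/
def thetaLFunction (s : ℂ) : ℂ :=
  (π : ℂ) ^ s * (M : ℂ) ^ (-s) * (Complex.Gamma s)⁻¹ * mellin (theta M ψ) s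

/-- **`thetaLFunction` is entire** (`1/Γ` and the Mellin transform of `θ_ψ` are entire).
[folklore] -/
theorem differentiable_thetaLFunction : Differentiable ℂ (thetaLFunction M ψ) := by
  have hπ : (π : ℂ) ≠ 0 := ofReal_ne_zero.mpr Real.pi_ne_zero
  have hM : (M : ℂ) ≠ 0 := Nat.cast_ne_zero.mpr (NeZero.ne M)
  have h1 : Differentiable ℂ fun s : ℂ ↦ (π : ℂ) ^ s := fun s ↦
    differentiableAt_id.const_cpow (Or.inl hπ)
  have h2 : Differentiable ℂ fun s : ℂ ↦ (M : ℂ) ^ (-s) := fun s ↦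
    differentiableAt_id.neg.const_cpow (Or.inl hM)
  unfold thetaLFunction
  exact ((h1.mul h2).mul Complex.differentiable_one_div_Gamma).mul
    (differentiable_mellin_theta M ψ)

omit [NeZero M] in
/-- `(a/b)^s = a^s / b^s` in `ℂ` for real `a ≥ 0`, `b > 0`. [folklore] -/
lemma ofReal_div_cpow {a b : ℝ} (ha : 0 ≤ a) (hb : 0 < b) (s : ℂ) :
    (((a / b : ℝ)) : ℂ) ^ s = (a : ℂ) ^ s / (b : ℂ) ^ s := by
  rw [div_eq_mul_inv, Complex.ofReal_mul, Complex.mul_cpow_ofReal_nonneg ha (inv_nonneg.mpr hb.le),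
    Complex.ofReal_inv, Complex.inv_cpow _ _ (by
      rw [Complex.arg_ofReal_of_nonneg hb.le]; exact Real.pi_ne_zero.symm), div_eq_mul_inv]

/-- For `Re s > 3/2`, `thetaLFunction M ψ s = ∑_{x ∈ ℤ[i]} ψ(x) x N(x)^{-s}` (absolutely
convergent). [folklore] -/
theorem hasSum_thetaLFunction (hψ : ∀ x y : ℤ[i], ψ (x + M * y) = ψ x) {s : ℂ}
    (hs : 3 / 2 < s.re) :
    HasSum (fun x : ℤ[i] ↦ ψ x * (x : ℂ) / (((x.norm : ℤ) : ℂ)) ^ s) (thetaLFunction M ψ s) := by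
  have hM : (0 : ℝ) < M := by exact_mod_cast Nat.pos_of_ne_zero (NeZero.ne M)
  have hπ : (π : ℂ) ≠ 0 := ofReal_ne_zero.mpr Real.pi_ne_zero
  have hMc : (M : ℂ) ≠ 0 := Nat.cast_ne_zero.mpr (NeZero.ne M)
  have hs0 : s ≠ 0 := fun h ↦ by rw [h, Complex.zero_re] at hs; linarith
  have h := hasSum_mellin_theta M ψ hψ hs
  set C : ℂ := (π : ℂ) ^ (-s) * Complex.Gamma s * (M : ℂ) ^ s with hC
  have hC0 : C ≠ 0 := mul_ne_zero (mul_ne_zero (Complex.cpow_ne_zero_iff.mpr (Or.inl hπ))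
    (Complex.Gamma_ne_zero_of_re_pos (by linarith))) (Complex.cpow_ne_zero_iff.mpr (Or.inl hMc))
  have h2 : HasSum (fun x : ℤ[i] ↦ C * (ψ x * (x : ℂ) / (((x.norm : ℤ) : ℂ)) ^ s))
      (mellin (theta M ψ) s) := by
    refine h.congr_fun fun x ↦ ?_
    rcases eq_or_ne x 0 with rfl | hx
    · simp
    · rw [ofReal_div_cpow (by exact_mod_cast GaussianInt.norm_nonneg x) hM, div_div_eq_mul_div, hC]
      push_cast
      ring
  have h3 := h2.mul_left C⁻¹
  have h4 : C⁻¹ * mellin (theta M ψ) s = thetaLFunction M ψ s := by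
    simp only [thetaLFunction, hC, mul_inv, Complex.cpow_neg, inv_inv]
    ring
  rw [h4] at h3
  refine h3.congr_fun fun x ↦ ?_
  rw [inv_mul_cancel_left₀ hC0]

/-- **The `L`-series of `θ_ψ` and its entire continuation.** For `ψ : ℤ[i] → ℂ` periodic modulo
`M` and `Re s > 3/2`, `∑_m c_ψ(m) m^{-s}` converges (absolutely) to `thetaLFunction M ψ s`.
[folklore] -/
theorem LSeriesHasSum_coeff (hψ : ∀ x y : ℤ[i], ψ (x + M * y) = ψ x) {s : ℂ}
    (hs : 3 / 2 < s.re) : LSeriesHasSum (coeff ψ) s (thetaLFunction M ψ s) :=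
  LSeriesHasSum_coeff_of_hasSum ψ (hasSum_thetaLFunction M ψ hψ hs)

/-- For `Re s > 3/2` the `L`-series `∑ c_ψ(m) m^{-s}` converges absolutely. [folklore] -/
theorem LSeriesSummable_coeff (hψ : ∀ x y : ℤ[i], ψ (x + M * y) = ψ x) {s : ℂ}
    (hs : 3 / 2 < s.re) : LSeriesSummable (coeff ψ) s :=
  (LSeriesHasSum_coeff M ψ hψ hs).LSeriesSummable

/-- For `Re s > 3/2`, `thetaLFunction M ψ s = ∑ c_ψ(m) m^{-s}` (Hecke 1920 §9; Koblitz Ch. II §5).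
[folklore] -/
theorem thetaLFunction_eq_LSeries (hψ : ∀ x y : ℤ[i], ψ (x + M * y) = ψ x) {s : ℂ}
    (hs : 3 / 2 < s.re) : thetaLFunction M ψ s = LSeries (coeff ψ) s :=
  ((LSeriesHasSum_coeff M ψ hψ hs).LSeries_eq).symm

/-- **Hecke–Koblitz: weight-one theta `L`-series of `ℚ(i)` are entire.** For every `M ≥ 1` and
every `ψ : ℤ[i] → ℂ` periodic modulo `M`, the Dirichlet series
`∑_{m ≥ 1} (∑_{x ∈ ℤ[i], N(x) = m} ψ(x) x) m^{-s}`, absolutely convergent for `Re s > 3/2`, is the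
restriction of an entire function (Hecke, Math. Z. 6 (1920); Koblitz, *Introduction to Elliptic
Curves and Modular Forms*, Ch. II §5, Theorem: the Hecke `L`-series `L(E_n, s) = L(χ̃_n, s)`
"extends to an entire function", proved there by exactly this theta-function argument).
[folklore] -/
theorem exists_differentiable_eq_LSeries_coeff (hψ : ∀ x y : ℤ[i], ψ (x + M * y) = ψ x) :
    ∃ G : ℂ → ℂ, Differentiable ℂ G ∧ ∀ s : ℂ, 3 / 2 < s.re → G s = LSeries (coeff ψ) s :=
  ⟨thetaLFunction M ψ, differentiable_thetaLFunction M ψ,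
    fun _ hs ↦ thetaLFunction_eq_LSeries M ψ hψ hs⟩

end GaussianTheta

end Literature.NumberTheory.LFunctions
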